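import Literature.AlgebraicGeometry.ShimuraVarieties.UnitaryShimuraCurveRecordBaseChangeWeak
import HarnessLib

/-!
# The complex comparison morphism ∕ isomorphism from disc-quotient PIECES — abstract form, and the weak-record bridge
# ([Milne 2005] §13 p. 118 «`T(g)` is a morphism over `ℂ`»; [Deligne 1979] 2.1.2–2.1.4; the input `gc` of ★ `WeakRecordGS.exists_iso_of_complexIso`)

Topic `AlgebraicGeometry/ShimuraVarieties`, namespace `…ShimuraVarieties.UnitaryCanonicalModel`.  THEOREMS ONLY (no definition, no instance,
no notation, no named fact, no `sorry`).  Cell `hodgecm-mathlib` (D-0151), programme P6 «MOD» (crux hLiu418 = stmt-HodgeConjecture-24832,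
`--supports`), GEN letters `stub_UNIF`∕`stub_UNIQ`∕`stub_RGD`: ★ `WeakRecordGS.exists_iso_of_complexIso` (p845822) needs a points-matching
`ℂ`-ISOMORPHISM `gc : ((S.M K) ⊗_L E′)_ℂ ≅ X_ℂ`; ★ `RecordSystemGS.exists_weakRecord_baseChange` (p845986) supplies the record side (`ptsY`,
`recipY`, the bridge `gY` to `(S.M K)_τ,ℂ`).  THIS file produces `gc` from the (F2c) `pieces` of `S` and a `pieces` presentation of `X_ℂ`
(GEN՚s complex uniformisation of the RSZ moduli space, in the record՚s disc-quotient format): §1 the comparison MORPHISM between two abstract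
pieces presentations (the proof text of ★ `RecordSystemGS.exists_heckeComplexTo` over abstract point-readings), §2 the ISOMORPHISM when points
separate morphisms on both sides, §3 the bridge for `Y := (S.M K) ⊗_L E′`.  HONEST LABEL: HC_CM is proved only modulo the 2 remaining named inputs
(hLiu418 24832, h413 24833) until rung 0 closes; this file is count-neutral capital.

## References
* [Milne2005ShimuraVarieties] J. S. Milne, *Introduction to Shimura varieties* (2005), §13 p. 118 L21–26, Lemma 5.13 p. 57, Thm. 13.7 p. 119.
* [Deligne1979ShimuraVarieties] P. Deligne, *Variétés de Shimura* (1979), 2.1.2–2.1.4, 2.2.6.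
* [Arapura2012] D. Arapura, *Algebraic Geometry over the Complex Numbers* (2012), Cor. 15.4.6.
-/

set_option autoImplicit false

noncomputable section

open Function MulAction Topology NumberField IsDedekindDomain CategoryTheory CategoryTheory.Limits Matrix
  AlgebraicGeometry
open scoped Matrix ComplexOrder
open Literature.AlgebraicGeometry.Motives Literature.NumberTheory.Automorphic Literature.NumberTheory.Automorphic.UnitaryGroup
open Literature.NumberTheory.Automorphic.Liu2021.AppendixC (C5.OpenCompactSubgroup C5.SmallLevel)
open Literature.NumberTheory.Automorphic.ShimuraDissection

namespace Literature.AlgebraicGeometry.ShimuraVarieties.UnitaryCanonicalModel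

variable {L : Type} [Field L] [NumberField L] [IsCMField L] {Jstar : Matrix (Fin 2) (Fin 2) L} {τ : L →+* ℂ}

/-- `U(J⋆)(L⁺)` preserves the negative cone of `J⋆^τ` (★ `smul_ratToGLℂ_mulVec_mem_negCone` at `c = 1`; private copy as in ★
`UnitaryShimuraCurveHeckeComplex`). [cite: Milne2005ShimuraVarieties, §5 (5.1) p. 56] -/
private theorem ratToGLℂ_mulVec_mem_negCone_aux₃ (γ : ↥(rational (↥(maximalRealSubfield L)) L (IsCMField.complexConj L) 2 Jstar))
    {v : Fin 2 → ℂ} (hv : v ∈ negCone (Jstar.map τ)) :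
    ((ratToGLℂ L Jstar τ γ : GL (Fin 2) ℂ) : Matrix (Fin 2) (Fin 2) ℂ) *ᵥ v ∈ negCone (Jstar.map τ) := by
  simpa only [one_smul] using smul_ratToGLℂ_mulVec_mem_negCone L Jstar τ γ one_ne_zero hv

/-! ### §1. The comparison morphism from pieces (abstract point-readings) -/

set_option maxHeartbeats 400000 in
/-- **The comparison morphism from PIECES, abstract form** ([Milne2005ShimuraVarieties] §13 p. 118 L25–26 «`T(g)` is a morphism of algebraic
varieties over `ℂ`»; [Deligne1979ShimuraVarieties] 2.1.2–2.1.4): let `Z`, `Z′` be `ℂ`-schemes whose complex points are read from `Sh_K(ℂ)`,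
`Sh_{K′}(ℂ)` by maps `u`, `u′`, each presented as a colimit cofan of compact disc quotients of the tree՚s kind (`UnitaryBallUniformisationDatum 1`,
hermitian matrix `J⋆^τ`, groups `τ(Γ_{J⋆}(g_q K g_q⁻¹))`, uniformised by `v ↦ u[v, g_qK]`) — the (F2c) `pieces` clause of ★ `RecordGS` with the
model replaced by an ABSTRACT `ℂ`-scheme and point-reading.  Then for `g⁻¹Kg ≤ K′` there is a `ℂ`-morphism `T : Z ⟶ Z′` with
`T (u[v, aK]) = u′[v, agK′]`, built piece by piece (★ `exists_hom_piece_ratToGLℂ`) and glued by `Cofan.IsColimit.desc` — the proof text of ★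
`RecordSystemGS.exists_heckeComplexTo` verbatim.  Consumers: the record (`Z := (M_K)_τ`, `u := bce ∘ pts⁻¹`), a weak record over `E′`, or the
RSZ moduli space՚s complex fibre with its disc uniformisation (GEN `stub_UNIF`). [cite: Milne2005ShimuraVarieties, §13 p. 118 L21–26; Lemma 5.13 p. 57]
[cite: Deligne1979ShimuraVarieties, 2.1.2–2.1.4] [cite: Arapura2012, §15.4 Cor. 15.4.6] -/
theorem exists_hom_of_pieces (K K' : Subgroup ↥(finAdelic (↥(maximalRealSubfield L)) L (IsCMField.complexConj L) 2 Jstar)) {Z Z' : SchemeOver ℂ}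
    (u : ShimuraSetGS L Jstar τ K → AlgPoints Z ℂ) (u' : ShimuraSetGS L Jstar τ K' → AlgPoints Z' ℂ)
    (piecesZ : (∃ (g : orbitRel.Quotient ↥(rational (↥(maximalRealSubfield L)) L (IsCMField.complexConj L) 2 Jstar)
          (CosetSpace (rationalToFinAdelic (↥(maximalRealSubfield L)) L (IsCMField.complexConj L) 2 Jstar) K) → ↥(finAdelic (↥(maximalRealSubfield L)) L (IsCMField.complexConj L) 2 Jstar))
      (_ : ∀ q, Quotient.mk'' (CosetSpace.pt (rationalToFinAdelic (↥(maximalRealSubfield L)) L (IsCMField.complexConj L) 2 Jstar) K (g q)) = q)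
      (Xp : orbitRel.Quotient ↥(rational (↥(maximalRealSubfield L)) L (IsCMField.complexConj L) 2 Jstar)
          (CosetSpace (rationalToFinAdelic (↥(maximalRealSubfield L)) L (IsCMField.complexConj L) 2 Jstar) K) → SchemeOver ℂ)
      (ι : ∀ q, Xp q ⟶ Z)
      (_ : Limits.IsColimit (Limits.Cofan.mk Z ι))
      (B : ∀ q, UnitaryBallUniformisationDatum 1 (Xp q)),
      ∀ q, (B q).Hℂ = Jstar.map τ ∧
        (B q).Γ.map (Matrix.GeneralLinearGroup.map ((B q).τ₁ : ↥(B q).E →+* ℂ)) =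
          (arithmeticLevel (↥(maximalRealSubfield L)) L (IsCMField.complexConj L) 2 Jstar
            (K.map (MulAut.conj (g q)).toMonoidHom)).map (Matrix.GeneralLinearGroup.map τ) ∧
        ∀ (v : Fin 2 → ℂ) (hv : v ∈ negCone (Jstar.map τ)),
          AlgPoints.map (ι q) ((B q).unif v) = u (ShimuraSetGS.mk L Jstar τ K v hv (g q))))
    (piecesZ' : (∃ (g : orbitRel.Quotient ↥(rational (↥(maximalRealSubfield L)) L (IsCMField.complexConj L) 2 Jstar)
          (CosetSpace (rationalToFinAdelic (↥(maximalRealSubfield L)) L (IsCMField.complexConj L) 2 Jstar) K') → ↥(finAdelic (↥(maximalRealSubfield L)) L (IsCMField.complexConj L) 2 Jstar))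
      (_ : ∀ q, Quotient.mk'' (CosetSpace.pt (rationalToFinAdelic (↥(maximalRealSubfield L)) L (IsCMField.complexConj L) 2 Jstar) K' (g q)) = q)
      (Xp : orbitRel.Quotient ↥(rational (↥(maximalRealSubfield L)) L (IsCMField.complexConj L) 2 Jstar)
          (CosetSpace (rationalToFinAdelic (↥(maximalRealSubfield L)) L (IsCMField.complexConj L) 2 Jstar) K') → SchemeOver ℂ)
      (ι : ∀ q, Xp q ⟶ Z')
      (_ : Limits.IsColimit (Limits.Cofan.mk Z' ι))
      (B : ∀ q, UnitaryBallUniformisationDatum 1 (Xp q)),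
      ∀ q, (B q).Hℂ = Jstar.map τ ∧
        (B q).Γ.map (Matrix.GeneralLinearGroup.map ((B q).τ₁ : ↥(B q).E →+* ℂ)) =
          (arithmeticLevel (↥(maximalRealSubfield L)) L (IsCMField.complexConj L) 2 Jstar
            (K'.map (MulAut.conj (g q)).toMonoidHom)).map (Matrix.GeneralLinearGroup.map τ) ∧
        ∀ (v : Fin 2 → ℂ) (hv : v ∈ negCone (Jstar.map τ)),
          AlgPoints.map (ι q) ((B q).unif v) = u' (ShimuraSetGS.mk L Jstar τ K' v hv (g q))))
    (g : ↥(finAdelic (↥(maximalRealSubfield L)) L (IsCMField.complexConj L) 2 Jstar)) (hK : ∀ k ∈ K, g⁻¹ * k * g ∈ K') :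
    ∃ Tc : Z ⟶ Z', ∀ (v : Fin 2 → ℂ) (hv : v ∈ negCone (Jstar.map τ)) (a : ↥(finAdelic (↥(maximalRealSubfield L)) L (IsCMField.complexConj L) 2 Jstar)),
      AlgPoints.map Tc (u (ShimuraSetGS.mk L Jstar τ K v hv a)) = u' (ShimuraSetGS.mk L Jstar τ K' v hv (a * g)) := by
  classical
  obtain ⟨gq, hgq, X, ι, hcol, B, hB⟩ := piecesZ
  obtain ⟨gq', hgq', X', ι', hcol', B', hB'⟩ := piecesZ'
  -- for each piece `q`: the target class `q'` and a rational `γ_q` with `(φ(γ_q) g_q g)⁻¹ g'_{q'} ∈ K'`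
  let q' : orbitRel.Quotient ↥(rational (↥(maximalRealSubfield L)) L (IsCMField.complexConj L) 2 Jstar)
      (CosetSpace (rationalToFinAdelic (↥(maximalRealSubfield L)) L (IsCMField.complexConj L) 2 Jstar) K) →
      orbitRel.Quotient ↥(rational (↥(maximalRealSubfield L)) L (IsCMField.complexConj L) 2 Jstar)
      (CosetSpace (rationalToFinAdelic (↥(maximalRealSubfield L)) L (IsCMField.complexConj L) 2 Jstar) K') :=
    fun q => Quotient.mk'' (CosetSpace.pt (rationalToFinAdelic (↥(maximalRealSubfield L)) L (IsCMField.complexConj L) 2 Jstar)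
      K' (gq q * g))
  have hrep : ∀ q, ∃ γ : ↥(rational (↥(maximalRealSubfield L)) L (IsCMField.complexConj L) 2 Jstar),
      ((rationalToFinAdelic (↥(maximalRealSubfield L)) L (IsCMField.complexConj L) 2 Jstar γ :
          ↥(finAdelic (↥(maximalRealSubfield L)) L (IsCMField.complexConj L) 2 Jstar)) * (gq q * g))⁻¹ *
        gq' (q' q) ∈ K' :=
    fun q => exists_rational_inv_mul_rep_mem hgq' (gq q * g)
  choose γ hγ using hrep
  -- the piece morphisms `X_q ⟶ X'_{q'}`, `[v] ↦ [γ_q^τ v]` (one-dimensional pieces: `exists_hom_piece_ratToGLℂ`)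
  have hpiece : ∀ q, ∃ f : X q ⟶ X' (q' q), ∀ v ∈ (B q).cone, AlgPoints.map f ((B q).unif v) =
      (B' (q' q)).unif (((ratToGLℂ L Jstar τ (γ q) : GL (Fin 2) ℂ) : Matrix (Fin 2) (Fin 2) ℂ) *ᵥ v) := fun q => by
    have hγq := hγ q
    rw [← mul_assoc] at hγq
    exact exists_hom_piece_ratToGLℂ (B q) (B' (q' q)) (hB q).1 (hB' (q' q)).1 (hB q).2.1 (hB' (q' q)).2.1 hK (γ q) hγq
  choose f hf using hpiece
  -- glue along the coproduct
  refine ⟨Cofan.IsColimit.desc hcol fun q => f q ≫ ι' (q' q), fun v hv a => ?_⟩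
  -- the point `[v, aK]` lies on the piece of `q = [a]` (`q` made opaque by `generalize`; no `set`, which is what costs
  -- the rank-3 twin its 1.6 M heartbeats)
  obtain ⟨δ, hδ⟩ := exists_rational_inv_mul_rep_mem hgq a
  generalize Quotient.mk'' (CosetSpace.pt (rationalToFinAdelic (↥(maximalRealSubfield L)) L (IsCMField.complexConj L) 2 Jstar)
    K a) = q at hδ
  -- the `g`-conjugate `(φ(δ) a g)⁻¹ (g_q g) ∈ K'`
  have hk' : ((rationalToFinAdelic (↥(maximalRealSubfield L)) L (IsCMField.complexConj L) 2 Jstar δ :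
        ↥(finAdelic (↥(maximalRealSubfield L)) L (IsCMField.complexConj L) 2 Jstar)) * (a * g))⁻¹ * (gq q * g) ∈ K' := by
    have h := hK _ hδ
    have heq : ((rationalToFinAdelic (↥(maximalRealSubfield L)) L (IsCMField.complexConj L) 2 Jstar δ :
          ↥(finAdelic (↥(maximalRealSubfield L)) L (IsCMField.complexConj L) 2 Jstar)) * (a * g))⁻¹ * (gq q * g) =
        g⁻¹ * (((rationalToFinAdelic (↥(maximalRealSubfield L)) L (IsCMField.complexConj L) 2 Jstar δ :
          ↥(finAdelic (↥(maximalRealSubfield L)) L (IsCMField.complexConj L) 2 Jstar)) * a)⁻¹ * gq q) * g := by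
      group
    rw [heq]
    exact h
  -- `[v, aK] = [x, g_q K]`, `[v, agK'] = [x, g_q g K']`, `[x, g_q g K'] = [γ_q^τ x, g'_{q'} K']` with `x := δ^τ v`
  have hxneg : (((ratToGLℂ L Jstar τ δ : GL (Fin 2) ℂ) : Matrix (Fin 2) (Fin 2) ℂ) *ᵥ v) ∈ negCone (Jstar.map τ) :=
    ratToGLℂ_mulVec_mem_negCone_aux₃ δ hv
  have hza : ShimuraSetGS.mk L Jstar τ K v hv a = ShimuraSetGS.mk L Jstar τ K _ hxneg (gq q) :=
    ShimuraSetGS.mk_eq_mk_ratToGLℂ_mulVec_of_mem L Jstar τ K δ v hv hxneg hδ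
  have hza' : ShimuraSetGS.mk L Jstar τ K' v hv (a * g) = ShimuraSetGS.mk L Jstar τ K' _ hxneg (gq q * g) :=
    ShimuraSetGS.mk_eq_mk_ratToGLℂ_mulVec_of_mem L Jstar τ K' δ v hv hxneg hk'
  have hγx : ((ratToGLℂ L Jstar τ (γ q) : GL (Fin 2) ℂ) : Matrix (Fin 2) (Fin 2) ℂ) *ᵥ (((ratToGLℂ L Jstar τ δ : GL (Fin 2) ℂ) : Matrix (Fin 2) (Fin 2) ℂ) *ᵥ v) ∈
      negCone (Jstar.map τ) :=
    ratToGLℂ_mulVec_mem_negCone_aux₃ (γ q) hxneg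
  have hxq : ShimuraSetGS.mk L Jstar τ K' _ hxneg (gq q * g) = ShimuraSetGS.mk L Jstar τ K' _ hγx (gq' (q' q)) :=
    ShimuraSetGS.mk_eq_mk_ratToGLℂ_mulVec_of_mem L Jstar τ K' (γ q) _ hxneg hγx (hγ q)
  -- read both sides through the pieces: a `calc` by `congrArg` only (NO `rw`/`simp` on the glued goal: abstracting
  -- `[v, aK]` there makes the unifier compare `a` with `a * g` by unfolding adèlic matrix products — the rank-3 twin's 1.6 M heartbeats)
  have hcone : (((ratToGLℂ L Jstar τ δ : GL (Fin 2) ℂ) : Matrix (Fin 2) (Fin 2) ℂ) *ᵥ v) ∈ (B q).cone := by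
    change _ ∈ negCone (B q).Hℂ
    rw [(hB q).1]
    exact hxneg
  calc AlgPoints.map (Cofan.IsColimit.desc hcol fun q => f q ≫ ι' (q' q))
        (u (ShimuraSetGS.mk L Jstar τ K v hv a))
      = AlgPoints.map (Cofan.IsColimit.desc hcol fun q => f q ≫ ι' (q' q))
          (u (ShimuraSetGS.mk L Jstar τ K _ hxneg (gq q))) :=
        congrArg (fun P => AlgPoints.map (Cofan.IsColimit.desc hcol fun q => f q ≫ ι' (q' q)) (u P)) hza
    _ = AlgPoints.map (Cofan.IsColimit.desc hcol fun q => f q ≫ ι' (q' q)) (AlgPoints.map (ι q) ((B q).unif (((ratToGLℂ L Jstar τ δ : GL (Fin 2) ℂ) : Matrix (Fin 2) (Fin 2) ℂ) *ᵥ v))) :=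
        congrArg (AlgPoints.map (Cofan.IsColimit.desc hcol fun q => f q ≫ ι' (q' q))) ((hB q).2.2 _ hxneg).symm
    _ = AlgPoints.map (ι q ≫ (Cofan.IsColimit.desc hcol fun q => f q ≫ ι' (q' q))) ((B q).unif (((ratToGLℂ L Jstar τ δ : GL (Fin 2) ℂ) : Matrix (Fin 2) (Fin 2) ℂ) *ᵥ v)) := (AlgPoints.map_comp_apply _ _ _).symm
    _ = AlgPoints.map (f q ≫ ι' (q' q)) ((B q).unif (((ratToGLℂ L Jstar τ δ : GL (Fin 2) ℂ) : Matrix (Fin 2) (Fin 2) ℂ) *ᵥ v)) :=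
        congrArg (fun φ => AlgPoints.map φ ((B q).unif (((ratToGLℂ L Jstar τ δ : GL (Fin 2) ℂ) : Matrix (Fin 2) (Fin 2) ℂ) *ᵥ v))) (Cofan.IsColimit.fac hcol _ q)
    _ = AlgPoints.map (ι' (q' q)) (AlgPoints.map (f q) ((B q).unif (((ratToGLℂ L Jstar τ δ : GL (Fin 2) ℂ) : Matrix (Fin 2) (Fin 2) ℂ) *ᵥ v))) := AlgPoints.map_comp_apply _ _ _
    _ = AlgPoints.map (ι' (q' q)) ((B' (q' q)).unif (((ratToGLℂ L Jstar τ (γ q) : GL (Fin 2) ℂ) : Matrix (Fin 2) (Fin 2) ℂ) *ᵥ (((ratToGLℂ L Jstar τ δ : GL (Fin 2) ℂ) : Matrix (Fin 2) (Fin 2) ℂ) *ᵥ v))) := congrArg _ (hf q _ hcone)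
    _ = u' (ShimuraSetGS.mk L Jstar τ K' _ hγx (gq' (q' q))) := (hB' (q' q)).2.2 _ hγx
    _ = u' (ShimuraSetGS.mk L Jstar τ K' v hv (a * g)) :=
        congrArg u' (hza'.trans hxq).symm
/-! ### §2. The comparison ISOMORPHISM from pieces on both sides -/

/-- **Two pieces presentations of the SAME Shimura set at one level give isomorphic `ℂ`-schemes**: if `Z`, `Z′` are reduced, locally of finite
type and separated over `ℂ`, every complex point of each is read from `Sh_K(ℂ)` (`u`, `u′` onto), and both carry (F2c)-pieces, then there is a
`ℂ`-isomorphism `Z ≅ Z′` carrying `u[v, aK]` to `u′[v, aK]` (§1 both ways at `g = 1`; the composites fix every complex point, hence are the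
identities — ★ `SchemeOver.hom_ext_of_forall_algPoints`). [cite: Milne2005ShimuraVarieties, §13 p. 118 L21–26 and Prop. 13.1 p. 117]
[cite: Deligne1979ShimuraVarieties, 2.1.2 («unique» [Borel])] -/
theorem exists_iso_of_pieces (K : Subgroup ↥(finAdelic (↥(maximalRealSubfield L)) L (IsCMField.complexConj L) 2 Jstar)) {Z Z' : SchemeOver ℂ}
    [LocallyOfFiniteType Z.hom] [IsReduced Z.left] [IsSeparated Z.hom]
    [LocallyOfFiniteType Z'.hom] [IsReduced Z'.left] [IsSeparated Z'.hom]
    (u : ShimuraSetGS L Jstar τ K → AlgPoints Z ℂ) (u' : ShimuraSetGS L Jstar τ K → AlgPoints Z' ℂ)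
    (hu : ∀ P : AlgPoints Z ℂ, ∃ m, u m = P) (hu' : ∀ P : AlgPoints Z' ℂ, ∃ m, u' m = P)
    (piecesZ : (∃ (g : orbitRel.Quotient ↥(rational (↥(maximalRealSubfield L)) L (IsCMField.complexConj L) 2 Jstar)
          (CosetSpace (rationalToFinAdelic (↥(maximalRealSubfield L)) L (IsCMField.complexConj L) 2 Jstar) K) → ↥(finAdelic (↥(maximalRealSubfield L)) L (IsCMField.complexConj L) 2 Jstar))
      (_ : ∀ q, Quotient.mk'' (CosetSpace.pt (rationalToFinAdelic (↥(maximalRealSubfield L)) L (IsCMField.complexConj L) 2 Jstar) K (g q)) = q)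
      (Xp : orbitRel.Quotient ↥(rational (↥(maximalRealSubfield L)) L (IsCMField.complexConj L) 2 Jstar)
          (CosetSpace (rationalToFinAdelic (↥(maximalRealSubfield L)) L (IsCMField.complexConj L) 2 Jstar) K) → SchemeOver ℂ)
      (ι : ∀ q, Xp q ⟶ Z)
      (_ : Limits.IsColimit (Limits.Cofan.mk Z ι))
      (B : ∀ q, UnitaryBallUniformisationDatum 1 (Xp q)),
      ∀ q, (B q).Hℂ = Jstar.map τ ∧
        (B q).Γ.map (Matrix.GeneralLinearGroup.map ((B q).τ₁ : ↥(B q).E →+* ℂ)) =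
          (arithmeticLevel (↥(maximalRealSubfield L)) L (IsCMField.complexConj L) 2 Jstar
            (K.map (MulAut.conj (g q)).toMonoidHom)).map (Matrix.GeneralLinearGroup.map τ) ∧
        ∀ (v : Fin 2 → ℂ) (hv : v ∈ negCone (Jstar.map τ)),
          AlgPoints.map (ι q) ((B q).unif v) = u (ShimuraSetGS.mk L Jstar τ K v hv (g q))))
    (piecesZ' : (∃ (g : orbitRel.Quotient ↥(rational (↥(maximalRealSubfield L)) L (IsCMField.complexConj L) 2 Jstar)
          (CosetSpace (rationalToFinAdelic (↥(maximalRealSubfield L)) L (IsCMField.complexConj L) 2 Jstar) K) → ↥(finAdelic (↥(maximalRealSubfield L)) L (IsCMField.complexConj L) 2 Jstar))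
      (_ : ∀ q, Quotient.mk'' (CosetSpace.pt (rationalToFinAdelic (↥(maximalRealSubfield L)) L (IsCMField.complexConj L) 2 Jstar) K (g q)) = q)
      (Xp : orbitRel.Quotient ↥(rational (↥(maximalRealSubfield L)) L (IsCMField.complexConj L) 2 Jstar)
          (CosetSpace (rationalToFinAdelic (↥(maximalRealSubfield L)) L (IsCMField.complexConj L) 2 Jstar) K) → SchemeOver ℂ)
      (ι : ∀ q, Xp q ⟶ Z')
      (_ : Limits.IsColimit (Limits.Cofan.mk Z' ι))
      (B : ∀ q, UnitaryBallUniformisationDatum 1 (Xp q)),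
      ∀ q, (B q).Hℂ = Jstar.map τ ∧
        (B q).Γ.map (Matrix.GeneralLinearGroup.map ((B q).τ₁ : ↥(B q).E →+* ℂ)) =
          (arithmeticLevel (↥(maximalRealSubfield L)) L (IsCMField.complexConj L) 2 Jstar
            (K.map (MulAut.conj (g q)).toMonoidHom)).map (Matrix.GeneralLinearGroup.map τ) ∧
        ∀ (v : Fin 2 → ℂ) (hv : v ∈ negCone (Jstar.map τ)),
          AlgPoints.map (ι q) ((B q).unif v) = u' (ShimuraSetGS.mk L Jstar τ K v hv (g q)))) :
    ∃ gc : Z ≅ Z', ∀ (v : Fin 2 → ℂ) (hv : v ∈ negCone (Jstar.map τ)) (a : ↥(finAdelic (↥(maximalRealSubfield L)) L (IsCMField.complexConj L) 2 Jstar)),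
      AlgPoints.map gc.hom (u (ShimuraSetGS.mk L Jstar τ K v hv a)) = u' (ShimuraSetGS.mk L Jstar τ K v hv a) := by
  have hK : ∀ k ∈ K, (1 : ↥(finAdelic (↥(maximalRealSubfield L)) L (IsCMField.complexConj L) 2 Jstar))⁻¹ * k * 1 ∈ K := fun k hk => by rwa [inv_one, one_mul, mul_one]
  obtain ⟨T, hT⟩ := exists_hom_of_pieces K K u u' piecesZ piecesZ' 1 hK
  obtain ⟨T', hT'⟩ := exists_hom_of_pieces K K u' u piecesZ' piecesZ 1 hK
  have h1 : T ≫ T' = 𝟙 Z := by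
    refine SchemeOver.hom_ext_of_forall_algPoints ℂ fun P => ?_
    obtain ⟨m, rfl⟩ := hu P
    obtain ⟨v, hv, a, rfl⟩ := ShimuraSetGS.mk_surjective L Jstar τ K m
    change AlgPoints.map (T ≫ T') (u _) = AlgPoints.map (𝟙 Z) (u _)
    rw [AlgPoints.map_comp_apply, hT, hT', mul_one, mul_one, AlgPoints.map_id_apply]
  have h2 : T' ≫ T = 𝟙 Z' := by
    refine SchemeOver.hom_ext_of_forall_algPoints ℂ fun P => ?_
    obtain ⟨m, rfl⟩ := hu' P
    obtain ⟨v, hv, a, rfl⟩ := ShimuraSetGS.mk_surjective L Jstar τ K m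
    change AlgPoints.map (T' ≫ T) (u' _) = AlgPoints.map (𝟙 Z') (u' _)
    rw [AlgPoints.map_comp_apply, hT', hT, mul_one, mul_one, AlgPoints.map_id_apply]
  exact ⟨⟨T, T', h1, h2⟩, fun v hv a => by rw [hT v hv a, mul_one]⟩

/-! ### §3. The weak-record bridge: `gc : ((S.M K) ⊗_L E′)_ℂ ≅ X_ℂ` from `S`՚s pieces and a pieces presentation of `X_ℂ` -/

variable {K₀ : C5.OpenCompactSubgroup ↥(finAdelic (↥(maximalRealSubfield L)) L (IsCMField.complexConj L) 2 Jstar)} {E : Type} [Field E] [Algebra L E] {τE : E →+* ℂ}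

set_option maxHeartbeats 400000 in
/-- **The input `gc` of ★ `WeakRecordGS.exists_iso_of_complexIso`, from pieces**: for a curve record `S`, `E′ ⊇ L` with `τ′` extending `τ`, a small
level `K`, an `E′`-scheme `X` (smooth of relative dimension 1, projective) with `ptsX : X_{τ′}(ℂ) ≃ₜ Sh_K(ℂ)` and a (F2c)-pieces presentation
of `X ⊗_{τ′} ℂ` read through `bce_{τ′} ∘ ptsX⁻¹` (GEN՚s complex uniformisation of the moduli space), and the record-side data `ptsY`, `gY` of ★
`RecordSystemGS.exists_weakRecord_baseChange`: a `ℂ`-ISOMORPHISM `gc : ((S.M K) ⊗_L E′) ⊗_{τ′} ℂ ≅ X ⊗_{τ′} ℂ` carrying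
`bce_{τ′}(ptsY⁻¹[v,aK])` to `bce_{τ′}(ptsX⁻¹[v,aK])` — §2 between the record՚s complex fibre (pieces (F2c) of `S`) and `X_ℂ`, composed with `gY`.
[cite: Milne2005ShimuraVarieties, §13 p. 118 L21–26; Thm. 13.7 p. 119] [cite: Deligne1979ShimuraVarieties, 2.1.2 and 2.2.6] -/
theorem RecordSystemGS.exists_complexIso_weak (S : RecordSystemGS L Jstar τ K₀) (K : C5.SmallLevel K₀)
    (X : SchemeOver E) [SmoothOfRelativeDimension 1 X.hom] (hX : IsProjectiveOver X)
    (ptsX : letI : Algebra E ℂ := τE.toAlgebra; ComplexPoints X ≃ₜ ShimuraSetGS L Jstar τ K.1.1)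
    (piecesX : letI : Algebra E ℂ := τE.toAlgebra
      (∃ (g : orbitRel.Quotient ↥(rational (↥(maximalRealSubfield L)) L (IsCMField.complexConj L) 2 Jstar)
          (CosetSpace (rationalToFinAdelic (↥(maximalRealSubfield L)) L (IsCMField.complexConj L) 2 Jstar) K.1.1) → ↥(finAdelic (↥(maximalRealSubfield L)) L (IsCMField.complexConj L) 2 Jstar))
      (_ : ∀ q, Quotient.mk'' (CosetSpace.pt (rationalToFinAdelic (↥(maximalRealSubfield L)) L (IsCMField.complexConj L) 2 Jstar) K.1.1 (g q)) = q)
      (Xp : orbitRel.Quotient ↥(rational (↥(maximalRealSubfield L)) L (IsCMField.complexConj L) 2 Jstar)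
          (CosetSpace (rationalToFinAdelic (↥(maximalRealSubfield L)) L (IsCMField.complexConj L) 2 Jstar) K.1.1) → SchemeOver ℂ)
      (ι : ∀ q, Xp q ⟶ ((Motives.baseChangeHom τE).obj X))
      (_ : Limits.IsColimit (Limits.Cofan.mk ((Motives.baseChangeHom τE).obj X) ι))
      (B : ∀ q, UnitaryBallUniformisationDatum 1 (Xp q)),
      ∀ q, (B q).Hℂ = Jstar.map τ ∧
        (B q).Γ.map (Matrix.GeneralLinearGroup.map ((B q).τ₁ : ↥(B q).E →+* ℂ)) =
          (arithmeticLevel (↥(maximalRealSubfield L)) L (IsCMField.complexConj L) 2 Jstar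
            (K.1.1.map (MulAut.conj (g q)).toMonoidHom)).map (Matrix.GeneralLinearGroup.map τ) ∧
        ∀ (v : Fin 2 → ℂ) (hv : v ∈ negCone (Jstar.map τ)),
          AlgPoints.map (ι q) ((B q).unif v) = (fun m => AlgPoints.baseChangeEquiv τE X (ptsX.symm m)) (ShimuraSetGS.mk L Jstar τ K.1.1 v hv (g q))))
    (ptsY : letI : Algebra E ℂ := τE.toAlgebra
      ComplexPoints ((Motives.baseChange L E).obj (S.M.obj K)) ≃ₜ ShimuraSetGS L Jstar τ K.1.1)
    (gY : (Motives.baseChangeHom τE).obj ((Motives.baseChange L E).obj (S.M.obj K)) ≅ (Motives.baseChangeHom τ).obj (S.M.obj K))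
    (hgY : letI : Algebra E ℂ := τE.toAlgebra
      ∀ (v : Fin 2 → ℂ) (hv : v ∈ negCone (Jstar.map τ)) (a : ↥(finAdelic (↥(maximalRealSubfield L)) L (IsCMField.complexConj L) 2 Jstar)),
        AlgPoints.map gY.hom (AlgPoints.baseChangeEquiv τE ((Motives.baseChange L E).obj (S.M.obj K))
            (ptsY.symm (ShimuraSetGS.mk L Jstar τ K.1.1 v hv a))) =
          (letI : Algebra L ℂ := τ.toAlgebra
           AlgPoints.baseChangeEquiv τ (S.M.obj K) ((S.pts K).symm (ShimuraSetGS.mk L Jstar τ K.1.1 v hv a)))) :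
    letI : Algebra E ℂ := τE.toAlgebra
    ∃ gc : (Motives.baseChangeHom τE).obj ((Motives.baseChange L E).obj (S.M.obj K)) ≅ (Motives.baseChangeHom τE).obj X,
      ∀ (v : Fin 2 → ℂ) (hv : v ∈ negCone (Jstar.map τ)) (a : ↥(finAdelic (↥(maximalRealSubfield L)) L (IsCMField.complexConj L) 2 Jstar)),
        AlgPoints.map gc.hom (AlgPoints.baseChangeEquiv τE ((Motives.baseChange L E).obj (S.M.obj K))
            (ptsY.symm (ShimuraSetGS.mk L Jstar τ K.1.1 v hv a))) =
          AlgPoints.baseChangeEquiv τE X (ptsX.symm (ShimuraSetGS.mk L Jstar τ K.1.1 v hv a)) := by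
  letI iE : Algebra E ℂ := τE.toAlgebra
  letI iL : Algebra L ℂ := τ.toAlgebra
  -- instances: both complex fibres reduced (smooth) and separated (projective)
  haveI : SmoothOfRelativeDimension 1 ((Motives.baseChangeHom τ).obj (S.M.obj K)).hom := S.smooth_complexFibre K
  haveI : Smooth ((Motives.baseChangeHom τ).obj (S.M.obj K)).hom := SmoothOfRelativeDimension.smooth 1 _
  haveI : IsReduced ((Motives.baseChangeHom τ).obj (S.M.obj K)).left :=
    isReduced_of_smooth_over_field ((Motives.baseChangeHom τ).obj (S.M.obj K)).hom
  haveI : IsProper ((Motives.baseChangeHom τ).obj (S.M.obj K)).hom := (S.projective_complexFibre K).isProper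
  haveI : SmoothOfRelativeDimension 1 ((Motives.baseChangeHom τE).obj X).hom :=
    HodgeTheory.smoothOfRelativeDimension_baseChangeHom_hom τE 1 X
  haveI : Smooth ((Motives.baseChangeHom τE).obj X).hom := SmoothOfRelativeDimension.smooth 1 _
  haveI : IsReduced ((Motives.baseChangeHom τE).obj X).left := isReduced_of_smooth_over_field ((Motives.baseChangeHom τE).obj X).hom
  haveI : IsProper ((Motives.baseChangeHom τE).obj X).hom := (hX.baseChange_obj ℂ).isProper
  -- every complex point of either fibre is read from `Sh_K(ℂ)`
  have hu : ∀ P : AlgPoints ((Motives.baseChangeHom τ).obj (S.M.obj K)) ℂ,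
      ∃ m, (fun m => AlgPoints.baseChangeEquiv τ (S.M.obj K) ((S.pts K).symm m)) m = P := fun P =>
    ⟨S.pts K ((AlgPoints.baseChangeEquiv τ (S.M.obj K)).symm P), by
      simp only [Homeomorph.symm_apply_apply, Equiv.apply_symm_apply]⟩
  have hu' : ∀ P : AlgPoints ((Motives.baseChangeHom τE).obj X) ℂ,
      ∃ m, (fun m => AlgPoints.baseChangeEquiv τE X (ptsX.symm m)) m = P := fun P =>
    ⟨ptsX ((AlgPoints.baseChangeEquiv τE X).symm P), by simp only [Homeomorph.symm_apply_apply, Equiv.apply_symm_apply]⟩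
  obtain ⟨gc₀, hgc₀⟩ := exists_iso_of_pieces K.1.1 (fun m => AlgPoints.baseChangeEquiv τ (S.M.obj K) ((S.pts K).symm m))
    (fun m => AlgPoints.baseChangeEquiv τE X (ptsX.symm m)) hu hu' (S.pieces K) piecesX
  refine ⟨gY ≪≫ gc₀, fun v hv a => ?_⟩
  rw [Iso.trans_hom, AlgPoints.map_comp_apply, hgY v hv a]
  exact hgc₀ v hv a

end Literature.AlgebraicGeometry.ShimuraVarieties.UnitaryCanonicalModel

end
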